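import Literature.Geometry.Kaehler.HolomorphicLineBundleCech
import Literature.Geometry.Kaehler.DolbeaultLerayBanach
import Literature.Geometry.Kaehler.AnalyticSetRegular
import HarnessLib

/-!
# Banach spaces of bounded holomorphic cochains of `𝒪(L)` on nested Leray covers (twisted Cartan–Serre, I)

Layer `Literature/Geometry/Kaehler`. The functional-analytic carriers of the Cartan–Serre finiteness
theorem `dim H¹(M, 𝒪(L)) < ∞` for the sheaf of sections of a cocycle line bundle `L` on a compact
complex manifold (H. Cartan, J.-P. Serre (1953); H. Grauert, R. Remmert, *Theorie der Steinschen
Räume* (1977), Kap. VI §4; O. Forster, *Lectures on Riemann Surfaces* (1981), §14), on the tree's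
nested Leray data `DolbeaultLerayDatum E M` (four nested finite covers `𝔘₀ ≪ 𝔘₁ ≪ 𝔘₂ ≪ 𝔘₃` by
chart-convex sets, `DolbeaultLerayBanach`) made SUBORDINATE to the trivialisation of `L` by a frame
map `fr` (`U_{3,i} ⊆ U_{fr i}`), exactly parallel to the scalar `DolbeaultLerayDatum.Bdd` — but for the
FUNCTION-valued twisted Čech complex `C^•(𝔘_l, 𝒪(L))` of `HolomorphicLineBundleCech`, whose sup
norms need no charts:

* `DolbeaultLerayDatum.framedCover D fr hfr l` — the level-`l` cover as a framed cover of `L`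
  (`framedCover_eq_shrink`: lower levels are shrinks of higher ones, definitionally);
* `DolbeaultLerayDatum.repL` — a cochain as the family of all its values `(J, m) ↦ c_J(m)`;
  `DolbeaultLerayDatum.BddL D fr hfr l a` — **the bounded holomorphic `a`-cochains of level `l`**
  (values in `ℓ^∞`), a structure, normed through the injective `toLpL` by the SUP NORM
  `‖c‖ = sup_{J, m} |c_J(m)|` (`norm_apply_le_normL`, `norm_le_of_forallL`);
* `DolbeaultLerayDatum.instCompleteSpaceBddL` — **a Banach space**: uniform limits of holomorphic
  functions on the chart sets `U_{l,J}` are holomorphic (the tree's several-variable Weierstrass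
  theorem `SCV.differentiableOn_of_tendstoLocallyUniformlyOn`, read in the chart of `J`);
* `DolbeaultLerayDatum.resL` — restriction to a lower level, a contraction;
* `DolbeaultLerayDatum.deltaL` — the twisted Čech differential is BOUNDED on level `l < 3` (the
  transition functions `g_{fr k, fr k'}` are bounded on `U_{l,J} ⊆ closure ⊆ U_{l+1,J}`, compact);
* `DolbeaultLerayDatum.isCompactOperator_resL` — **restriction to a strictly lower level is a compact
  operator** (Montel's theorem in the chart of each tuple, on the compact sets
  `e_J(closure U_{l,J}) ⊆ C_{l',J}`; Grauert–Remmert VI Satz 4.1 "vollstetig").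

Everything is proved; the definitions are the carriers and the three operators.

## References

* H. Grauert, R. Remmert, *Theorie der Steinschen Räume* (1977), Kap. VI §§1–4. [GrauertRemmert1977]
* H. Cartan, J.-P. Serre, C. R. Acad. Sci. Paris 237 (1953) 128–130. [CartanSerre1953]
* O. Forster, *Lectures on Riemann Surfaces* (1981), §14 (Lemma 14.7, Thm. 14.9). [Forster1981]
-/

noncomputable section

open scoped Manifold ContDiff Topology
open Set Filter Function Metric Literature.NumberTheory.Transcendental Literature.Analysis.Complex
  Literature.Algebra.Homology

namespace Literature.Geometry.Kaehler

variable {ι : Type*} {E : Type*} [NormedAddCommGroup E] [NormedSpace ℂ E]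
  {M : Type*} [TopologicalSpace M] [ChartedSpace E M]

/-! ### Holomorphic functions on chart sets, read in the chart -/

section ChartSet

variable [IsManifold 𝓘(ℂ, E) ω M] {p : M} {C : Set E}

/-- A function holomorphic on `chartSet p C` read in the chart at `p` is holomorphic on `C` (`C` inside
the chart target). [cite: VoisinHodgeI2002, §2.2.1] -/
theorem differentiableOn_comp_symm_of_mdifferentiableOn_chartSet (hCt : C ⊆ (extChartAt 𝓘(ℝ, E) p).target)
    {f : M → ℂ} (hf : MDifferentiableOn 𝓘(ℂ, E) 𝓘(ℂ, ℂ) f (chartSet 𝓘(ℝ, E) p C)) :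
    DifferentiableOn ℂ (f ∘ (extChartAt 𝓘(ℝ, E) p).symm) C :=
  (MDifferentiableOn.differentiableOn_extChartAt_symm hf p).mono fun _ hy ↦
    ⟨hCt hy, symm_mem_chartSet hCt hy⟩

/-- A function on `M` which vanishes off `chartSet p C` and agrees on it with `G ∘ (chart at p)` for a
`G` holomorphic on the open `C` is an element of `𝒪(chartSet p C)`. [cite: VoisinHodgeI2002, §2.2.1] -/
theorem mem_holFunOn_chartSet_of_differentiableOn {g : M → ℂ} {G : E → ℂ}
    (hG : DifferentiableOn ℂ G C) (hg : ∀ m ∈ chartSet 𝓘(ℝ, E) p C, g m = G (extChartAt 𝓘(ℝ, E) p m))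
    (hg0 : ∀ m ∉ chartSet 𝓘(ℝ, E) p C, g m = 0) : g ∈ holFunOn E (chartSet 𝓘(ℝ, E) p C) := by
  refine ⟨?_, hg0⟩
  have hcomp : MDifferentiableOn 𝓘(ℂ, E) 𝓘(ℂ, ℂ) (G ∘ extChartAt 𝓘(ℂ, E) p) (chartSet 𝓘(ℝ, E) p C) :=
    (mdifferentiableOn_iff_differentiableOn.2 hG).comp
      ((mdifferentiableOn_extChartAt (I := 𝓘(ℂ, E))).mono fun m hm ↦ by
        rw [← extChartAt_source 𝓘(ℂ, E)]; exact (mem_chartSet_iff.1 hm).1)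
      fun m hm ↦ (mem_chartSet_iff.1 hm).2
  exact hcomp.congr fun m hm ↦ hg m hm

end ChartSet

namespace DolbeaultLerayDatum

variable (D : DolbeaultLerayDatum E M) {L : HolomorphicLineBundle ι E M} (fr : ↥D.s → ι)
  (hfr : ∀ i, D.U 3 i ⊆ L.baseSet (fr i))

/-! ### The levels as framed covers of `L` -/

/-- **The level-`l` cover of a Leray datum subordinate to `L`, as a framed cover** (frames `fr`;
every level lies in the top level, which lies in the trivialising sets). [cite: GrauertRemmert1977, Kap. VI §4.1] -/
abbrev framedCover (l : Fin 4) : L.FramedCover ↥D.s where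
  U := D.U l
  isOpen := D.isOpen l
  frame := fr
  subset i := (D.mono l 3 (Fin.le_last l) i).trans (hfr i)

/-- The members of the framed cover of level `l` (definitional). [folklore] -/
@[simp]
theorem framedCover_U (l : Fin 4) : (D.framedCover fr hfr l).U = D.U l :=
  rfl

/-- The frames of the framed covers (definitional). [folklore] -/
@[simp]
theorem framedCover_frame (l : Fin 4) : (D.framedCover fr hfr l).frame = fr :=
  rfl

/-- **Lower levels are shrinks of higher levels**, definitionally (so that the cochain spaces of
`HolomorphicLineBundleCech` at a lower level ARE those of the shrunk cover). [folklore] -/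
theorem framedCover_eq_shrink {l l' : Fin 4} (h : l ≤ l') :
    D.framedCover fr hfr l = (D.framedCover fr hfr l').shrink (D.U l) (D.isOpen l) (D.mono l l' h) :=
  rfl

/-! ### The value map and the bounded cochains -/

/-- **All the values of a cochain**: `(J, m) ↦ c_J(m)` (zero off `U_{l,J}` by the normalisation of
`holFunOn`). [cite: GrauertRemmert1977, Kap. VI §4.1] -/
def repL (l : Fin 4) (a : ℕ) : (D.framedCover fr hfr l).Cochain a →ₗ[ℂ] ((Fin (a + 1) → ↥D.s) × M → ℂ) where
  toFun c i := (c i.1 : M → ℂ) i.2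
  map_add' _ _ := rfl
  map_smul' _ _ := rfl

/-- The value map, evaluated. [folklore] -/
@[simp]
theorem repL_apply {l : Fin 4} {a : ℕ} (c : (D.framedCover fr hfr l).Cochain a) (i : (Fin (a + 1) → ↥D.s) × M) :
    D.repL fr hfr l a c i = (c i.1 : M → ℂ) i.2 :=
  rfl

/-- A cochain with values bounded on the sets `U_{l,J}` has values in `ℓ^∞`. [folklore] -/
theorem memℓp_of_forallL {l : Fin 4} {a : ℕ} {c : (D.framedCover fr hfr l).Cochain a} (K : ℝ)
    (h : ∀ (J : Fin (a + 1) → ↥D.s), ∀ m ∈ cechSet (D.U l) J, ‖(c J : M → ℂ) m‖ ≤ K) :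
    Memℓp (D.repL fr hfr l a c) ⊤ := by
  refine memℓp_infty ⟨max K 0, ?_⟩
  rintro _ ⟨⟨J, m⟩, rfl⟩
  dsimp only [repL_apply]
  by_cases hm : m ∈ cechSet (D.U l) J
  · exact (h J m hm).trans (le_max_left _ _)
  · rw [holFunOn.apply_of_notMem _ hm, norm_zero]
    exact le_max_right _ _

/-- **The bounded holomorphic `a`-cochains of `𝒪(L)` of level `l`**: the cochains whose values lie
in `ℓ^∞` (a structure, so that it carries the sup norm and no other topology — the cochain spaces
themselves carry the topology of pointwise convergence). [cite: GrauertRemmert1977, Kap. VI §4.1] -/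
structure BddL (l : Fin 4) (a : ℕ) where
  /-- the underlying holomorphic cochain [folklore] -/
  val : (D.framedCover fr hfr l).Cochain a
  /-- its values are bounded [folklore] -/
  memℓp : Memℓp (D.repL fr hfr l a val) ⊤

namespace BddL

variable {D fr hfr} {l : Fin 4} {a : ℕ}

/-- Bounded cochains with the same underlying cochain are equal. [folklore] -/
@[ext] theorem ext {c c' : D.BddL fr hfr l a} (h : c.val = c'.val) : c = c' := by
  cases c; cases c'; congr

/-- The underlying-cochain map is injective. [folklore] -/
theorem val_injective : Injective (BddL.val : D.BddL fr hfr l a → (D.framedCover fr hfr l).Cochain a) :=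
  fun _ _ h ↦ ext h

/-- The underlying cochain of an anonymous-constructor term. [folklore] -/
@[simp] theorem val_mk (g : (D.framedCover fr hfr l).Cochain a) (hg : Memℓp (D.repL fr hfr l a g) ⊤) :
    (⟨g, hg⟩ : D.BddL fr hfr l a).val = g := rfl

/-- Structure instance transported from the underlying cochains. [folklore] -/
instance : Zero (D.BddL fr hfr l a) := ⟨⟨0, by rw [map_zero]; exact zero_memℓp⟩⟩
/-- Structure instance transported from the underlying cochains. [folklore] -/
instance : Add (D.BddL fr hfr l a) := ⟨fun c c' ↦ ⟨c.val + c'.val, by rw [map_add]; exact c.memℓp.add c'.memℓp⟩⟩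
/-- Structure instance transported from the underlying cochains. [folklore] -/
instance : SMul ℂ (D.BddL fr hfr l a) := ⟨fun r c ↦ ⟨r • c.val, by rw [map_smul]; exact c.memℓp.const_smul r⟩⟩
/-- Negation, through the complex scalar `-1` (so that boundedness is inherited). [folklore] -/
instance : Neg (D.BddL fr hfr l a) := ⟨fun c ↦ (-1 : ℂ) • c⟩
/-- Subtraction, through negation. [folklore] -/
instance : Sub (D.BddL fr hfr l a) := ⟨fun c c' ↦ c + -c'⟩
/-- Natural scalars, through the complex ones. [folklore] -/
instance : SMul ℕ (D.BddL fr hfr l a) := ⟨fun n c ↦ (n : ℂ) • c⟩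
/-- Integer scalars, through the complex ones. [folklore] -/
instance : SMul ℤ (D.BddL fr hfr l a) := ⟨fun n c ↦ (n : ℂ) • c⟩

/-- Underlying cochain of `0`. [folklore] -/
@[simp] theorem val_zero : (0 : D.BddL fr hfr l a).val = 0 := rfl
/-- Underlying cochain of a sum. [folklore] -/
@[simp] theorem val_add (c c' : D.BddL fr hfr l a) : (c + c').val = c.val + c'.val := rfl
/-- Underlying cochain of a complex multiple. [folklore] -/
@[simp] theorem val_smul (r : ℂ) (c : D.BddL fr hfr l a) : (r • c).val = r • c.val := rfl
/-- Underlying cochain of a negative. [folklore] -/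
@[simp] theorem val_neg (c : D.BddL fr hfr l a) : (-c).val = -c.val := neg_one_smul ℂ c.val
/-- Underlying cochain of a difference. [folklore] -/
@[simp] theorem val_sub (c c' : D.BddL fr hfr l a) : (c - c').val = c.val - c'.val :=
  (congrArg (c.val + ·) (val_neg c')).trans (sub_eq_add_neg c.val c'.val).symm
/-- Underlying cochain of a natural multiple. [folklore] -/
theorem val_nsmul (c : D.BddL fr hfr l a) (n : ℕ) : (n • c).val = n • c.val := Nat.cast_smul_eq_nsmul ℂ n c.val
/-- Underlying cochain of an integer multiple. [folklore] -/
theorem val_zsmul (c : D.BddL fr hfr l a) (n : ℤ) : (n • c).val = n • c.val := Int.cast_smul_eq_zsmul ℂ n c.val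

/-- Structure instance transported from the underlying cochains. [folklore] -/
instance : AddCommGroup (D.BddL fr hfr l a) :=
  val_injective.addCommGroup _ val_zero val_add val_neg val_sub val_nsmul val_zsmul

/-- The underlying cochain, as an additive homomorphism. [folklore] -/
def valHom : D.BddL fr hfr l a →+ (D.framedCover fr hfr l).Cochain a where
  toFun := val
  map_zero' := rfl
  map_add' _ _ := rfl

/-- Structure instance transported from the underlying cochains. [folklore] -/
instance : Module ℂ (D.BddL fr hfr l a) := val_injective.module ℂ valHom val_smul

end BddL

/-- **The embedding into `ℓ^∞`** by the values. [cite: GrauertRemmert1977, Kap. VI §4.1] -/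
def toLpL (l : Fin 4) (a : ℕ) :
    D.BddL fr hfr l a →ₗ[ℂ] ↥(lp (fun _ : (Fin (a + 1) → ↥D.s) × M ↦ ℂ) ⊤) where
  toFun c := ⟨D.repL fr hfr l a c.val, c.memℓp⟩
  map_add' c c' := by
    apply Subtype.ext
    change D.repL fr hfr l a (c.val + c'.val) = D.repL fr hfr l a c.val + D.repL fr hfr l a c'.val
    rw [map_add]
  map_smul' r c := by
    apply Subtype.ext
    change D.repL fr hfr l a (r • c.val) = r • D.repL fr hfr l a c.val
    rw [map_smul]

/-- The embedding into `ℓ^∞`, evaluated. [folklore] -/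
@[simp]
theorem toLpL_apply {l : Fin 4} {a : ℕ} (c : D.BddL fr hfr l a) (i : (Fin (a + 1) → ↥D.s) × M) :
    (D.toLpL fr hfr l a c : (Fin (a + 1) → ↥D.s) × M → ℂ) i = (c.val i.1 : M → ℂ) i.2 :=
  rfl

/-- **A bounded cochain is determined by its values.** [folklore] -/
theorem toLpL_injective (l : Fin 4) (a : ℕ) : Injective (D.toLpL fr hfr l a) := by
  intro c c' h
  apply BddL.ext
  funext J
  apply Subtype.ext
  funext m
  exact congrArg (fun f : ↥(lp (fun _ : (Fin (a + 1) → ↥D.s) × M ↦ ℂ) ⊤) ↦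
    (f : (Fin (a + 1) → ↥D.s) × M → ℂ) (J, m)) h

/-- **The sup norm** `‖c‖ = sup_{J, m} |c_J(m)|`, induced from `ℓ^∞`. [cite: GrauertRemmert1977, Kap. VI §4.1] -/
instance instNormedAddCommGroupBddL (l : Fin 4) (a : ℕ) : NormedAddCommGroup (D.BddL fr hfr l a) :=
  NormedAddCommGroup.induced (D.BddL fr hfr l a) ↥(lp (fun _ : (Fin (a + 1) → ↥D.s) × M ↦ ℂ) ⊤)
    (D.toLpL fr hfr l a) (D.toLpL_injective fr hfr l a)

/-- The sup norm is a complex Banach-space norm. [cite: GrauertRemmert1977, Kap. VI §4.1] -/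
instance instNormedSpaceBddL (l : Fin 4) (a : ℕ) : NormedSpace ℂ (D.BddL fr hfr l a) where
  norm_smul_le r c := by
    change ‖D.toLpL fr hfr l a (r • c)‖ ≤ ‖r‖ * ‖D.toLpL fr hfr l a c‖
    rw [map_smul]
    exact norm_smul_le r _

/-- The norm is the `ℓ^∞` norm of the values. [folklore] -/
theorem norm_defL {l : Fin 4} {a : ℕ} (c : D.BddL fr hfr l a) : ‖c‖ = ‖D.toLpL fr hfr l a c‖ :=
  rfl

/-- **Each value is bounded by the norm.** [cite: GrauertRemmert1977, Kap. VI §4.1] -/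
theorem norm_apply_le_normL {l : Fin 4} {a : ℕ} (c : D.BddL fr hfr l a) (J : Fin (a + 1) → ↥D.s) (m : M) :
    ‖(c.val J : M → ℂ) m‖ ≤ ‖c‖ :=
  lp.norm_apply_le_norm ENNReal.top_ne_zero (D.toLpL fr hfr l a c) (J, m)

/-- **A uniform bound on the values on the sets `U_{l,J}` bounds the norm.** [cite: GrauertRemmert1977, Kap. VI §4.1] -/
theorem norm_le_of_forallL {l : Fin 4} {a : ℕ} (c : D.BddL fr hfr l a) {K : ℝ} (hK : 0 ≤ K)
    (h : ∀ (J : Fin (a + 1) → ↥D.s), ∀ m ∈ cechSet (D.U l) J, ‖(c.val J : M → ℂ) m‖ ≤ K) :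
    ‖c‖ ≤ K := by
  rw [norm_defL]
  refine lp.norm_le_of_forall_le hK fun i ↦ ?_
  obtain ⟨J, m⟩ := i
  rw [toLpL_apply]
  by_cases hm : m ∈ cechSet (D.U l) J
  · exact h J m hm
  · rw [holFunOn.apply_of_notMem _ hm, norm_zero]
    exact hK

/-! ### Completeness -/

section Complete

variable [FiniteDimensional ℂ E] [IsManifold 𝓘(ℂ, E) ω M]

/-- **The bounded holomorphic cochains form a Banach space**: the range of the embedding into `ℓ^∞`
is closed, because a uniform limit of elements of `𝒪(U_{l,J})` is again holomorphic on the chart set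
`U_{l,J}` (Weierstrass, read in the chart of `J`) and vanishes off it. [cite: GrauertRemmert1977, Kap. VI §4.1] -/
theorem isClosed_range_toLpL (l : Fin 4) (a : ℕ) : IsClosed (range (D.toLpL fr hfr l a)) := by
  refine isSeqClosed_iff_isClosed.1 fun u f hu huf ↦ ?_
  choose c hc using hu
  -- uniform convergence of all values
  have hunif : ∀ J : Fin (a + 1) → ↥D.s, TendstoUniformly (fun n m ↦ ((c n).val J : M → ℂ) m)
      (fun m ↦ (f : (Fin (a + 1) → ↥D.s) × M → ℂ) (J, m)) atTop := by
    intro J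
    refine Metric.tendstoUniformly_iff.2 fun ε hε ↦ ?_
    obtain ⟨N, hN⟩ := Metric.tendsto_atTop.1 huf ε hε
    refine eventually_atTop.2 ⟨N, fun n hn m ↦ ?_⟩
    have h1 := lp.norm_apply_le_norm ENNReal.top_ne_zero (f - u n) (J, m)
    rw [← hc n, lp.coeFn_sub, Pi.sub_apply, toLpL_apply] at h1
    rw [dist_eq_norm]
    refine h1.trans_lt ?_
    rw [← dist_eq_norm, hc n, dist_comm]
    exact hN n hn
  -- the limit components are in `𝒪(U_{l,J})`
  have hmem : ∀ J : Fin (a + 1) → ↥D.s, (fun m ↦ (f : (Fin (a + 1) → ↥D.s) × M → ℂ) (J, m)) ∈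
      holFunOn E (cechSet (D.U l) J) := by
    intro J
    have h0 : ∀ m ∉ cechSet (D.U l) J, (f : (Fin (a + 1) → ↥D.s) × M → ℂ) (J, m) = 0 := fun m hm ↦
      tendsto_nhds_unique ((hunif J).tendsto_at m)
        ((tendsto_const_nhds (x := (0 : ℂ)) (f := (atTop : Filter ℕ))).congr fun n ↦
          (holFunOn.apply_of_notMem ((c n).val J) hm).symm)
    rw [D.cechSet_eq a J l] at h0 ⊢
    set φ := extChartAt 𝓘(ℝ, E) (D.ctr a J) with hφ
    have hdiff : DifferentiableOn ℂ ((fun m ↦ (f : (Fin (a + 1) → ↥D.s) × M → ℂ) (J, m)) ∘ φ.symm) (D.C a J l) := by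
      refine SCV.differentiableOn_of_tendstoLocallyUniformlyOn (l := (atTop : Filter ℕ)) (D.C_open a J l)
        (f := fun n ↦ ((c n).val J : M → ℂ) ∘ φ.symm) (fun n ↦ ?_) ?_
      · refine differentiableOn_comp_symm_of_mdifferentiableOn_chartSet (D.C_subset a J l) ?_
        rw [← D.cechSet_eq a J l]
        exact holFunOn.mdifferentiableOn _
      · exact ((hunif J).comp φ.symm).tendstoUniformlyOn.tendstoLocallyUniformlyOn
    exact mem_holFunOn_chartSet_of_differentiableOn hdiff
      (fun m hm ↦ by
        simp only [Function.comp_apply]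
        rw [φ.left_inv (chartSet_subset_source 𝓘(ℝ, E) _ _ hm)])
      h0
  -- the limit cochain
  refine ⟨⟨fun J ↦ ⟨_, hmem J⟩, ?_⟩, ?_⟩
  · have e : D.repL fr hfr l a (fun J ↦ ⟨_, hmem J⟩) = (f : (Fin (a + 1) → ↥D.s) × M → ℂ) := by
      funext ⟨J, m⟩; rfl
    rw [e]
    exact f.2
  · apply Subtype.ext
    funext ⟨J, m⟩
    rfl

/-- **The bounded holomorphic cochains of `𝒪(L)` form a Banach space.** [cite: GrauertRemmert1977, Kap. VI §4.1] -/
instance instCompleteSpaceBddL (l : Fin 4) (a : ℕ) : CompleteSpace (D.BddL fr hfr l a) := by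
  have hiso : Isometry (D.toLpL fr hfr l a) := fun _ _ ↦ rfl
  rw [completeSpace_iff_isComplete_range hiso.isUniformInducing]
  exact (D.isClosed_range_toLpL fr hfr l a).isComplete

end Complete

/-! ### Restriction to a lower level -/

/-- Restriction of a bounded cochain to a lower level is bounded. [folklore] -/
theorem res_memℓp {l l' : Fin 4} (h : l ≤ l') {a : ℕ} (c : D.BddL fr hfr l' a) :
    Memℓp (D.repL fr hfr l a ((D.framedCover fr hfr l').res (D.U l) (D.isOpen l) (D.mono l l' h) a c.val)) ⊤ :=
  D.memℓp_of_forallL fr hfr ‖c‖ fun J m hm ↦ by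
    rw [(D.framedCover fr hfr l').res_apply_apply_of_mem _ _ _ _ hm]
    exact D.norm_apply_le_normL fr hfr c J m

/-- **Restriction of bounded holomorphic cochains of `𝒪(L)` to a lower level**, a contraction.
[cite: GrauertRemmert1977, Kap. VI §4.1] -/
def resL {l l' : Fin 4} (h : l ≤ l') (a : ℕ) : D.BddL fr hfr l' a →L[ℂ] D.BddL fr hfr l a :=
  LinearMap.mkContinuous
    { toFun := fun c ↦ ⟨_, D.res_memℓp fr hfr h c⟩
      map_add' := fun c c' ↦ BddL.ext
        (map_add ((D.framedCover fr hfr l').res (D.U l) (D.isOpen l) (D.mono l l' h) a) c.val c'.val)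
      map_smul' := fun r c ↦ BddL.ext
        (LinearMap.map_smul ((D.framedCover fr hfr l').res (D.U l) (D.isOpen l) (D.mono l l' h) a) r c.val) }
    1 fun c ↦ by
      rw [one_mul]
      refine D.norm_le_of_forallL fr hfr _ (norm_nonneg c) fun J m hm ↦ ?_
      change ‖((D.framedCover fr hfr l').res (D.U l) (D.isOpen l) (D.mono l l' h) a c.val J : M → ℂ) m‖ ≤ ‖c‖
      rw [(D.framedCover fr hfr l').res_apply_apply_of_mem _ _ _ _ hm]
      exact D.norm_apply_le_normL fr hfr c J m

/-- Underlying cochain of a restriction. [folklore] -/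
@[simp]
theorem val_resL {l l' : Fin 4} (h : l ≤ l') {a : ℕ} (c : D.BddL fr hfr l' a) :
    (D.resL fr hfr h a c).val = (D.framedCover fr hfr l').res (D.U l) (D.isOpen l) (D.mono l l' h) a c.val :=
  rfl

/-! ### The twisted Čech differential is bounded below the top level -/

/-- **The transition functions along the faces are bounded on the sets of a level `l < l'`** (they
are continuous on the trivialising sets, which contain the compact `closure U_{l,J} ⊆ U_{l',J}`).
[cite: GrauertRemmert1977, Kap. VI §4.1] -/
theorem exists_norm_trans_le [T2Space M] [CompactSpace M] {l l' : Fin 4} (h : l < l') (a : ℕ) :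
    ∃ A : ℝ, 0 ≤ A ∧ ∀ (J : Fin (a + 2) → ↥D.s) (j : Fin (a + 2)), ∀ m ∈ cechSet (D.U l) J,
      ‖(D.framedCover fr hfr l).trans J (Fin.succAbove j) m‖ ≤ A := by
  have key : ∀ (J : Fin (a + 2) → ↥D.s) (j : Fin (a + 2)), ∃ B : ℝ, ∀ m ∈ closure (cechSet (D.U l) J),
      ‖(D.framedCover fr hfr l).trans J (Fin.succAbove j) m‖ ≤ B := by
    intro J j
    have hK : IsCompact (closure (cechSet (D.U l) J)) := isClosed_closure.isCompact
    refine hK.exists_bound_of_continuousOn (((L.mdifferentiableOn_coordChange _ _).continuousOn).mono fun m hm ↦ ?_)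
    have hm' : m ∈ cechSet (D.U l') J := D.closure_subset l l' h _ J hm
    exact ⟨(D.framedCover fr hfr l').cechSet_subset_baseSet J _ hm',
      (D.framedCover fr hfr l').cechSet_subset_baseSet J 0 hm'⟩
  choose B hB using key
  set A : ℝ := ∑ J, ∑ j, max (B J j) 0 with hA
  have hA0 : 0 ≤ A := Finset.sum_nonneg fun J _ ↦ Finset.sum_nonneg fun j _ ↦ le_max_right _ _
  refine ⟨A, hA0, fun J j m hm ↦ ?_⟩
  have h1 : max (B J j) 0 ≤ ∑ j', max (B J j') 0 :=
    Finset.single_le_sum (f := fun j' ↦ max (B J j') 0) (fun _ _ ↦ le_max_right _ _) (Finset.mem_univ j)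
  have h2 : ∑ j', max (B J j') 0 ≤ A :=
    Finset.single_le_sum (f := fun J' ↦ ∑ j', max (B J' j') 0)
      (fun _ _ ↦ Finset.sum_nonneg fun _ _ ↦ le_max_right _ _) (Finset.mem_univ J)
  exact ((hB J j m (subset_closure hm)).trans (le_max_left _ _)).trans (h1.trans h2)

/-- **The twisted Čech differential is bounded in the sup norms of a level `l < l'`.**
[cite: GrauertRemmert1977, Kap. VI §4.1] -/
theorem exists_delta_boundL [T2Space M] [CompactSpace M] {l l' : Fin 4} (h : l < l') (a : ℕ) :
    ∃ A : ℝ, 0 ≤ A ∧ ∀ (c : D.BddL fr hfr l a) (J : Fin (a + 2) → ↥D.s), ∀ m ∈ cechSet (D.U l) J,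
      ‖((D.framedCover fr hfr l).delta a c.val J : M → ℂ) m‖ ≤ A * ‖c‖ := by
  obtain ⟨A, hA0, hA⟩ := D.exists_norm_trans_le fr hfr h a
  refine ⟨(a + 2) * A, by positivity, fun c J m hm ↦ ?_⟩
  rw [(D.framedCover fr hfr l).delta_apply_apply_of_mem _ hm]
  calc ‖∑ j : Fin (a + 2), (-1 : ℂ) ^ (j : ℕ) * ((D.framedCover fr hfr l).trans J (Fin.succAbove j) m *
        (c.val (J ∘ Fin.succAbove j) : M → ℂ) m)‖
      ≤ ∑ j : Fin (a + 2), ‖(-1 : ℂ) ^ (j : ℕ) * ((D.framedCover fr hfr l).trans J (Fin.succAbove j) m *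
        (c.val (J ∘ Fin.succAbove j) : M → ℂ) m)‖ := norm_sum_le _ _
    _ ≤ ∑ j : Fin (a + 2), A * ‖c‖ := Finset.sum_le_sum fun j _ ↦ by
        rw [norm_mul, norm_pow, norm_neg, norm_one, one_pow, one_mul, norm_mul]
        exact mul_le_mul (hA J j m hm) (D.norm_apply_le_normL fr hfr c _ m) (norm_nonneg _) hA0
    _ = (a + 2) * A * ‖c‖ := by
        rw [Finset.sum_const, Finset.card_univ, Fintype.card_fin, nsmul_eq_mul]
        push_cast
        ring

/-- **The twisted Čech differential on bounded holomorphic cochains of `𝒪(L)`** of a level `l` below a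
level `l'`, a bounded operator. [cite: GrauertRemmert1977, Kap. VI §4.1] -/
def deltaL [T2Space M] [CompactSpace M] {l l' : Fin 4} (h : l < l') (a : ℕ) :
    D.BddL fr hfr l a →L[ℂ] D.BddL fr hfr l (a + 1) :=
  LinearMap.mkContinuousOfExistsBound
    { toFun := fun c ↦ ⟨(D.framedCover fr hfr l).delta a c.val,
        (D.exists_delta_boundL fr hfr h a).elim fun _ hA ↦ D.memℓp_of_forallL fr hfr _ fun J m hm ↦ hA.2 c J m hm⟩
      map_add' := fun c c' ↦ BddL.ext (map_add ((D.framedCover fr hfr l).delta a) c.val c'.val)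
      map_smul' := fun r c ↦ BddL.ext (LinearMap.map_smul ((D.framedCover fr hfr l).delta a) r c.val) }
    ((D.exists_delta_boundL fr hfr h a).imp fun _ hA c ↦
      D.norm_le_of_forallL fr hfr _ (mul_nonneg hA.1 (norm_nonneg _)) fun J m hm ↦ hA.2 c J m hm)

/-- Underlying cochain of a differential. [folklore] -/
@[simp]
theorem val_deltaL [T2Space M] [CompactSpace M] {l l' : Fin 4} (h : l < l') {a : ℕ} (c : D.BddL fr hfr l a) :
    (D.deltaL fr hfr h a c).val = (D.framedCover fr hfr l).delta a c.val :=
  rfl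

/-! ### Restriction to a strictly lower level is compact (Montel) -/

section Montel

variable [FiniteDimensional ℂ E] [CompactSpace M] [IsManifold 𝓘(ℂ, E) ω M]

/-- **Montel extraction for restriction**: a bounded sequence of bounded holomorphic cochains of
`𝒪(L)` of level `l'` has a subsequence whose restrictions to a level `l < l'` converge (Montel's
theorem for the values read in the chart of each tuple, holomorphic and uniformly bounded on the
`C_{l',J}`, uniformly on the compact sets `e_J(closure U_{l,J})`). [cite: GrauertRemmert1977, Kap. VI §4.2] -/
theorem exists_subseq_tendsto_resL {l l' : Fin 4} (h : l < l') (a : ℕ)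
    (u : ℕ → D.BddL fr hfr l' a) (hu : ∀ n, ‖u n‖ ≤ 1) :
    ∃ (c : D.BddL fr hfr l a) (φ : ℕ → ℕ), StrictMono φ ∧
      Tendsto (fun n ↦ D.resL fr hfr h.le a (u (φ n))) atTop (𝓝 c) := by
  -- the values of level `l'` read in the charts
  have hFd : ∀ (n : ℕ) (J : Fin (a + 1) → ↥D.s), DifferentiableOn ℂ
      (((u n).val J : M → ℂ) ∘ (extChartAt 𝓘(ℝ, E) (D.ctr a J)).symm) (D.C a J l') := fun n J ↦ by
    refine differentiableOn_comp_symm_of_mdifferentiableOn_chartSet (D.C_subset a J l') ?_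
    rw [← D.cechSet_eq a J l']
    exact holFunOn.mdifferentiableOn _
  have hFb : ∀ (n : ℕ) (J : Fin (a + 1) → ↥D.s), ∀ z ∈ D.C a J l',
      ‖(((u n).val J : M → ℂ) ∘ (extChartAt 𝓘(ℝ, E) (D.ctr a J)).symm) z‖ ≤ 1 := fun n J z _ ↦
    (D.norm_apply_le_normL fr hfr (u n) J _).trans (hu n)
  obtain ⟨g, φ, hφ, hg⟩ := exists_strictMono_tendstoUniformlyOn_finset Finset.univ (fun J ↦ D.C_open a J l')
    (fun J ↦ D.isCompact_image_closure h J) (fun J ↦ D.image_closure_subset_C h J)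
    (f := fun n J ↦ ((u n).val J : M → ℂ) ∘ (extChartAt 𝓘(ℝ, E) (D.ctr a J)).symm) hFd hFb
  -- the limit cochain of level `l`
  classical
  have hmem : ∀ J : Fin (a + 1) → ↥D.s, (fun m ↦ if m ∈ cechSet (D.U l) J then
      g J (extChartAt 𝓘(ℝ, E) (D.ctr a J) m) else 0) ∈ holFunOn E (cechSet (D.U l) J) := by
    intro J
    rw [D.cechSet_eq a J l]
    exact mem_holFunOn_chartSet_of_differentiableOn ((hg J (Finset.mem_univ J)).1.mono (D.C_mono h.le a J))
      (fun m hm ↦ if_pos hm) (fun m hm ↦ if_neg hm)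
  have hc_apply : ∀ (J : Fin (a + 1) → ↥D.s) {m : M}, m ∈ cechSet (D.U l) J →
      ((⟨_, hmem J⟩ : holFunOn E (cechSet (D.U l) J)) : M → ℂ) m = g J (extChartAt 𝓘(ℝ, E) (D.ctr a J) m) :=
    fun J m hm ↦ if_pos hm
  have hcb : Memℓp (D.repL fr hfr l a fun J ↦ ⟨_, hmem J⟩) ⊤ := D.memℓp_of_forallL fr hfr 1 fun J m hm ↦ by
    rw [hc_apply J hm]
    exact (hg J (Finset.mem_univ J)).2.1 _ (D.C_mono h.le a J (D.extChartAt_mem_C hm))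
  refine ⟨⟨_, hcb⟩, φ, hφ, Metric.tendsto_atTop.2 fun ε hε ↦ ?_⟩
  have hev : ∀ᶠ n in atTop, ∀ J : Fin (a + 1) → ↥D.s,
      ∀ y ∈ extChartAt 𝓘(ℝ, E) (D.ctr a J) '' closure (cechSet (D.U l) J),
        dist (g J y) ((((u (φ n)).val J : M → ℂ) ∘ (extChartAt 𝓘(ℝ, E) (D.ctr a J)).symm) y) < ε / 2 :=
    eventually_all.2 fun J ↦ Metric.tendstoUniformlyOn_iff.1 (hg J (Finset.mem_univ J)).2.2 (ε / 2) (half_pos hε)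
  obtain ⟨N, hN⟩ := eventually_atTop.1 hev
  refine ⟨N, fun n hn ↦ ?_⟩
  rw [dist_eq_norm]
  refine (D.norm_le_of_forallL fr hfr _ (half_pos hε).le fun J m hm ↦ ?_).trans_lt (half_lt_self hε)
  rw [BddL.val_sub, Pi.sub_apply, Submodule.coe_sub, Pi.sub_apply, val_resL,
    (D.framedCover fr hfr l').res_apply_apply_of_mem _ _ _ _ hm, BddL.val_mk, hc_apply J hm]
  have hy := hN n hn J _ ⟨m, subset_closure hm, rfl⟩
  simp only [Function.comp_apply, (extChartAt 𝓘(ℝ, E) (D.ctr a J)).left_inv (D.cechSet_subset_source l J hm)] at hy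
  rw [← dist_eq_norm, dist_comm]
  exact hy.le

/-- **Restriction of bounded holomorphic cochains of `𝒪(L)` to a strictly lower level is a compact
operator** (Montel; Grauert–Remmert (1977), Kap. VI, Satz 4.1). [cite: GrauertRemmert1977, Kap. VI §4.2] -/
theorem isCompactOperator_resL {l l' : Fin 4} (h : l < l') (a : ℕ) :
    IsCompactOperator (D.resL fr hfr h.le a) :=
  isCompactOperator_of_subseq _ (D.exists_subseq_tendsto_resL fr hfr h a)

end Montel

end DolbeaultLerayDatum

end Literature.Geometry.Kaehler
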